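import Summits.QuantumAdvantage.QuantumAdvantage.Theses.LinnikCubicClassGroups
import Summits.QuantumAdvantage.QuantumAdvantage.Theorems.LinnikCubicClassGroupsPureCubicClassGroupFBQPStubClassStageQry
import Literature.Computability.Cryptography.CubicClassSamplingSpecs
import Literature.Computability.Cryptography.CubicClassStageParams
import Literature.Computability.Cryptography.ShiftSamplingReadout
import Literature.Computability.Complexity.CodeFPListKit
import Literature.Computability.Complexity.CodeFPStrings
import Literature.Computability.Complexity.CodeFPStringKit
import Literature.Computability.Complexity.CodeFPBudgets

/-!
# Crux `LinnikCubicClassGroups.PureCubicClassGroupFBQP` (stmt-QuantumAdvantage-11544) — ASM programs (Post)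

Line `arakelov-giant-step-cycle`, stub `stub_classStageAssembly` (S5b-ASM), helper `classStage_post`: the
POST-processor of the class-group stage. On `⟨⟨w, bin r⟩, y⟩` (`w = ⟨x, ⟨⟨f, a, b⟩, ps⟩⟩` well formed, `r` the advice,
`y` the string measured by the quantum family on the padded input `z = pre ⟨w, bin r⟩`) it outputs `bin 1` when
`ps = []` and otherwise `bin` of the capped post-processor `PostParams.postOutC` of `CubicClassSamplingSpecs.lean`, run
with the parameters `postP |w| a b (decodeNat x) ps` of `CubicClassStageParams` on the characters
`P.charOf |z| y u`, `u < P.nU |z|`, read off `y` by the given reader `rd`. Program: recompute `z` (composition with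
`pre ∈ FP`), read the characters (`rd ∈ FP`, headed list to raw list), assemble the argument code `postArgsE` (the five
small parameters `Tp, leOf, sOf, 0, topOf` in unary — `topOf = (Z+1)² − s − ℓe·T` by unary squaring —, `K0Of`, `hB`
in binary, from the kit of `…StubClassStageQry.lean`; `decodeNat x` by `Brick.canonF`), apply the given program of
`postOutC`, branch on `ps = []` (`rawIsEmpty`). The block-length hypothesis of the statement is not needed by the
program. The input is read typed (code `pairE (pairE ⟨input format⟩ natE) strE` of `(((x, (f, a, b), ps), r), y)`).
Definition-free.
-/

-- the problem namespace repeats the summit name (`QuantumAdvantage.QuantumAdvantage`)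
set_option linter.dupNamespace false

namespace Summit.QuantumAdvantage.QuantumAdvantage.Theorems.LinnikCubicClassGroups

open Computability (encodeNat decodeNat encodingNatBool)
open Literature.Computability.Complexity (boolPair boolUnpair CodeFP FP encodingListNatBool comp_mem_FP)
open Literature.Computability.Complexity.CodeFP
open Literature.Computability.Complexity.Brick (canonF canonF_mem_FP canonF_eq_encodeNat_decodeNat)
open Literature.Computability.Cryptography (CubicClassTable.WalkFns CubicClassTable.Inst ShiftSampling.SSParams)
open Literature.Computability.Cryptography.CubicClassSampling (TableArgs tableArgsE instOfArgs PostArgs postArgsE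
  postOfArgs)
open Literature.Computability.Cryptography.CubicClassStageParams

/-- **ASM helper `classStage_post`** (registered): the post-processor of the class-group stage is in `FP` — on
`⟨⟨w, bin r⟩, y⟩` with `w` well formed it outputs `bin 1` if `ps = []`, else `bin (postOutC (postP |w| a b m ps) cs)`
with `m = decodeNat x` and `cs` the characters of the `P.nU |z|` units read off `y` by `rd` (`z = pre ⟨w, bin r⟩`). -/
theorem classStage_post :
    ∀ (P : ShiftSampling.SSParams) (rd pre : List Bool → List Bool), rd ∈ FP → pre ∈ FP →
      CodeFP unE unE P.nU → CodeFP unE unE P.L →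
      (∀ z v : List Bool, rd (boolPair z v) = encodingListNatBool.encode ((List.range (P.nU z.length)).map (P.charOf z.length v))) →
      CodeFP postArgsE natE (fun q : PostArgs => (postOfArgs q).postOutC q.2) →
      ∃ post : List Bool → List Bool, post ∈ FP ∧
        ∀ (x : List Bool) (f a b : ℕ) (ps : List ℕ) (r : ℕ) (w y : List Bool),
          w = boolPair x (boolPair (boolPair (encodeNat f) (boolPair (encodeNat a) (encodeNat b))) (encodingListNatBool.encode ps)) →
          topOf w.length a b ps + sOf w.length a b + leOf w.length a b ps * Tp ps = P.L (pre (boolPair w (encodeNat r))).length →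
          post (boolPair (boolPair w (encodeNat r)) y) =
            encodeNat (if ps = [] then 1 else
              (postP w.length a b (decodeNat x) ps).postOutC
                ((List.range (P.nU (pre (boolPair w (encodeNat r))).length)).map
                  (P.charOf (pre (boolPair w (encodeNat r))).length y))) := by
  intro P rd pre hrd hpre _ _ hrdE hpost
  -- ### the programs, on the typed input `c = (((x, (f, a, b), ps), r), y)`
  have hD : CodeFP strE natE decodeNat := ⟨canonF, canonF_mem_FP, canonF_eq_encodeNat_decodeNat⟩
  -- the kit's arguments `(|w|, a, b, ps)`, the raw `ps`, the radicand `m = decodeNat x`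
  have hq := classStage_codeFP_args.comp (fst (pairE (pairE strE (pairE (pairE natE (pairE natE natE)) (listE natE))) natE) strE).fst'
  have hps := (rawOfList natE).comp (fst (pairE (pairE strE (pairE (pairE natE (pairE natE natE)) (listE natE))) natE) strE).fst'.snd'.snd'
  have hx := hD.comp (fst (pairE (pairE strE (pairE (pairE natE (pairE natE natE)) (listE natE))) natE) strE).fst'.fst'
  -- `z = pre ⟨w, bin r⟩` and the characters read off `y`
  have hwr : CodeFP (pairE (pairE (pairE strE (pairE (pairE natE (pairE natE natE)) (listE natE))) natE) strE) strE (fun c => pairE (pairE strE (pairE (pairE natE (pairE natE natE)) (listE natE))) natE c.1) := fst _ _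
  have hz : CodeFP (pairE (pairE (pairE strE (pairE (pairE natE (pairE natE natE)) (listE natE))) natE) strE) strE (fun c => pre (pairE (pairE strE (pairE (pairE natE (pairE natE natE)) (listE natE))) natE c.1)) :=
    ((of_fn pre hpre fun _ => rfl : CodeFP strE strE pre).comp hwr :)
  obtain ⟨G, hG, hGe⟩ := hz.pair (snd (pairE (pairE strE (pairE (pairE natE (pairE natE natE)) (listE natE))) natE) strE)
  have hchars : CodeFP (pairE (pairE (pairE strE (pairE (pairE natE (pairE natE natE)) (listE natE))) natE) strE) (listE natE) (fun c => (List.range (P.nU (pre (pairE (pairE strE (pairE (pairE natE (pairE natE natE)) (listE natE))) natE c.1)).length)).map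
      (P.charOf (pre (pairE (pairE strE (pairE (pairE natE (pairE natE natE)) (listE natE))) natE c.1)).length c.2)) :=
    ⟨rd ∘ G, comp_mem_FP hrd hG, fun c => by
      rw [Function.comp_apply, hGe, pairE_apply, hrdE]
      exact congrFun (listE_eq encodingNatBool) _⟩
  have hcs := (rawOfList natE).comp hchars
  -- the argument code `postArgsE` of the capped post-processor and its value
  have hargs := ((classStage_codeFP_Tp.comp hps).pair ((classStage_codeFP_leOf.comp hq).pair
    ((classStage_codeFP_sOf.comp hq).pair ((const (eβ := unE) _ (0 : ℕ)).pair ((classStage_codeFP_topOf.comp hq).pair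
    ((classStage_codeFP_K0Of.comp (hq.pair hx)).pair (classStage_codeFP_hB.comp hx))))))).pair hcs
  have hout := hpost.comp hargs
  -- branch on `ps = []`
  obtain ⟨F, hF, hFe⟩ := ((rawIsEmpty natE).comp hps).ite (const _ (1 : ℕ)) hout
  refine ⟨F, hF, fun x f a b ps r w y hw _ => ?_⟩
  rw [show encodingListNatBool.encode ps = listE natE ps from congrFun (listE_eq encodingNatBool) ps] at hw
  subst hw
  have e := hFe (((x, (f, a, b), ps), r), y)
  cases ps with
  | nil => exact e
  | cons p l => exact e

end Summit.QuantumAdvantage.QuantumAdvantage.Theorems.LinnikCubicClassGroups
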